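import Summits.SmoothPoincare4.SmoothPoincare4.Theses.CylinderEntropy
import Summits.SmoothPoincare4.SmoothPoincare4.Theorems.CylinderEntropyCylinderRungTwoKillingFluxDefs
import Summits.SmoothPoincare4.SmoothPoincare4.Theorems.CylinderEntropyCylinderRungTwoDissipationBudget
import Summits.SmoothPoincare4.SmoothPoincare4.Theorems.CylinderEntropyCylinderRungTwoAreaToFloorOfQuantization
import Summits.SmoothPoincare4.SmoothPoincare4.Theorems.CylinderEntropyCylinderRungTwoAreaQuantizationOfAllard
import Literature.Geometry.GeometricMeasureTheory.AllardIntegralDensityOfLimits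
import HarnessLib

/-!
# Route `CylinderEntropy`, item `ImmortalAreaToFloor` (stmt-SmoothPoincare4-17197): REDUCTIONS

The item (route-choice 2026-08-16) is AREA TO THE FLOOR ALONG IMMORTAL THIN CYLINDER FLOWS: for a compact connected
`4`-manifold `M` and an immortal smooth mean curvature flow `(F t)_{t ≥ T}` of embedded cross-sections of
`N = S⁴ × ℝ ⊂ ℝ⁶`, every slice separating the ends with cylinder entropy `λ_cyl < 2`, some slice has area
`μH⁴(F_t(M)) ≤ (1 + ε) μH⁴(S⁴)`.  Its statement is the registered stub `stub_areaToFloor` of line `killing-flux` of the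
crux `CylinderRungTwo` (stmt-SmoothPoincare4-7631) with the vocabulary `IsCylinderMCF` / `SeparatesEnds` / `cylEntropy`
UNFOLDED into the route items' typing.  This file carries the pure-logic glue, over landed theorems only:

* `immortalAreaToFloor_of_stubShape` / `stubShape_of_immortalAreaToFloor` — the unfolded item and the folded
  `stub_areaToFloor` shape are EQUIVALENT (the structure `IsCylinderMCF` has exactly the item's eight flow hypotheses as
  fields; `SeparatesEnds (Set.range (F t))` and `cylEntropy (Set.range (F t))` unfold by `rfl`);
* `immortalAreaToFloor_of_areaQuantization` — the route's crux `AreaQuantization` (stmt-SmoothPoincare4-17175, the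
  flow-free GMT core) implies the item, through the landed `stub_dissipationBudget` and
  `helper_areaToFloorOfQuantization` (`vol ≤ A_∞ = m · vol < 2 vol` forces `m = 1`);
* `immortalAreaToFloor_of_allard` — Allard's integrality of limits (named fact
  `Literature.Geometry.GeometricMeasureTheory.Allard1972_integralDensityOfLimits_cylinderCrossSections`, statement
  only) implies the item, through the landed `helper_areaQuantizationOfAllard`; CONDITIONAL on that fact.

So the item's residual analytic debt is exactly the residual of `AreaQuantization`: INTEGRALITY of the weak limit
`μ = (μH⁴(S⁴))⁻¹ μH⁴⌊S⁴ ⊗ σ` of the area measures at good times (Allard 1972, Thm. 6.4 / §3.5), everything else being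
landed (`…CylinderRungTwo{LimitMeasureExists,ProductTestLimit,Equidistribution,ProductIdentification,
DensityOfProductMeasure,AtomicQuantization}.lean`).  No definition, no `sorry`, no new named fact here.

References: W. K. Allard, *On the first variation of a varifold*, Ann. of Math. 95 (1972) 417–491, Thm. 6.4, §3.5;
K. Brakke, *The motion of a surface by its mean curvature* (1978), §3; R. S. Hamilton, Comm. Anal. Geom. 1 (1993)
127–137.
-/

noncomputable section

-- the prescribed namespace `Summit.SmoothPoincare4.SmoothPoincare4.…` repeats `SmoothPoincare4`
set_option linter.dupNamespace false

open MeasureTheory Set Filter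
open scoped Manifold ContDiff ENNReal Topology BigOperators

namespace Summit.SmoothPoincare4.SmoothPoincare4.Theorems

open Literature.Geometry.Riemannian
open Literature.Geometry.Lorentzian Literature.Geometry.Lorentzian.PseudoRiemannianMetric
open Literature.Geometry.Riemannian.SphericalCylinderEntropy (cylEntropy cylDensity cylKernel)
open Summit.SmoothPoincare4.SmoothPoincare4.Cruxes.CylinderRungTwo.KillingFlux

/-- **The folded `stub_areaToFloor` shape implies the item `ImmortalAreaToFloor` (stmt-SmoothPoincare4-17197) as
typed.**  The eight flow hypotheses of the item are exactly the fields of `IsCylinderMCF M F ν T` (the flow equation is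
stated with the hypothesis `himm t ht` as the immersion witness of `meanCurvature`, which is the field
`isSpacelikeImmersion t ht` of the assembled structure by proof irrelevance), the separation hypothesis is
`SeparatesEnds (Set.range (F t))` and the entropy hypothesis is `cylEntropy (Set.range (F t)) < 2`, both by `rfl`.
[folklore] -/
theorem immortalAreaToFloor_of_stubShape
    (h : ∀ (M : Type) [TopologicalSpace M] [T2Space M] [SecondCountableTopology M]
      [ChartedSpace (EuclideanSpace ℝ (Fin 4)) M] [IsManifold (𝓡 4) ∞ M] [CompactSpace M]
      [ConnectedSpace M]
      (F : ℝ → M → EuclideanSpace ℝ (Fin 6)) (ν : ℝ → M → EuclideanSpace ℝ (Fin 6)) (T : ℝ),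
      IsCylinderMCF M F ν T →
      (∀ t, T ≤ t → SeparatesEnds (Set.range (F t))) →
      (∀ t, T ≤ t → cylEntropy (Set.range (F t)) < 2) →
      ∀ ε : ℝ, 0 < ε → ∃ t : ℝ, T ≤ t ∧
        μH[4] (Set.range (F t)) ≤
          ENNReal.ofReal (1 + ε) * μH[4] (Metric.sphere (0 : EuclideanSpace ℝ (Fin 5)) 1)) :
    (haveI : (Literature.Geometry.Riemannian.euclideanMetric (EuclideanSpace ℝ (Fin 6))).HasLeviCivita := Literature.Geometry.Riemannian.instHasLeviCivitaEuclideanMetric; ∀ (M : Type) [TopologicalSpace M] [T2Space M] [SecondCountableTopology M] [ChartedSpace (EuclideanSpace ℝ (Fin 4)) M] [IsManifold (𝓡 4) ∞ M] [CompactSpace M] [ConnectedSpace M] (F : ℝ → M → EuclideanSpace ℝ (Fin 6)) (ν : ℝ → M → EuclideanSpace ℝ (Fin 6)) (T : ℝ), (∃ U : Set ℝ, IsOpen U ∧ Set.Ici T ⊆ U ∧ ContMDiffOn (𝓘(ℝ, ℝ).prod (𝓡 4)) (𝓡 6) ∞ (fun q : ℝ × M => F q.1 q.2) (U ×ˢ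 Set.univ)) → (∀ t, T ≤ t → Manifold.IsSmoothEmbedding (𝓡 4) (𝓡 6) ∞ (F t)) → (∀ t, T ≤ t → ∀ x, ∑ i : Fin 5, F t x (Fin.castSucc i) ^ 2 = 1) → ∀ himm : (∀ t, T ≤ t → (Literature.Geometry.Riemannian.euclideanMetric (EuclideanSpace ℝ (Fin 6))).IsSpacelikeImmersion (𝓡 4) (F t)), (∀ t, T ≤ t → (Literature.Geometry.Riemannian.euclideanMetric (EuclideanSpace ℝ (Fin 6))).IsUnitNormal (𝓡 4) (F t) (ν t) 1) → (∀ t, T ≤ t → ∀ x, ∑ i : Fin 5, ν t x (Fin.castSucc i) * F t x (Fin.castSucc i) = 0) → (∀ t, T ≤ t → ContMDiff (𝓡 4) (𝓡 6) ∞ (ν t)) → (∀ t (ht : T ≤ t) (x : M), mfderiv 𝓘(ℝ, ℝ) (𝓡 6) (fun s => F s x) t (1 : ℝ) = -((Literature.Geometry.Riemannian.euclideanMetric (EuclideanSpace ℝ (Fin 6))).meanCurvature (F t) Literature.Geometry.Lorentzian.PseudoRiemannianMetric.contMDiff_pullbackBilin_holds (himm t ht) (ν t) x) • ν t x) → (∀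 t, T ≤ t → (∃ R : ℝ, ∀ a b : EuclideanSpace ℝ (Fin 6), ∑ i : Fin 5, a (Fin.castSucc i) ^ 2 = 1 → ∑ i : Fin 5, b (Fin.castSucc i) ^ 2 = 1 → a 5 ≤ -R → R ≤ b 5 → ¬ JoinedIn ({z : EuclideanSpace ℝ (Fin 6) | ∑ i : Fin 5, z (Fin.castSucc i) ^ 2 = 1} \ Set.range (F t)) a b)) → (∀ t, T ≤ t → (⨆ (p : EuclideanSpace ℝ (Fin 6)) (_ : ∑ i : Fin 5, p (Fin.castSucc i) ^ 2 = 1) (τ : ℝ) (_ : 0 < τ), (μH[4] (Metric.sphere (0 : EuclideanSpace ℝ (Fin 5)) 1))⁻¹ * ∫⁻ z in Set.range (F t), ENNReal.ofReal ((∑' k : ℕ, Real.exp (-((k : ℝ) * ((k : ℝ) + 3)) * τ) * ((2 * (k : ℝ) + 3) / 3) * ∑ l ∈ Finset.range (k / 2 + 1), (-1 : ℝ) ^ l * (∏ j ∈ Finset.range (k - l), ((3 : ℝ) / 2 + (j : ℝ))) / (((l.factorial : ℕ) : ℝ) * (((k - 2 * l).factorial : ℕ) : ℝ)) * (2 * ∑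 i : Fin 5, z (Fin.castSucc i) * p (Fin.castSucc i)) ^ (k - 2 * l)) * Real.exp (-((z 5 - p 5) ^ 2) / (4 * τ))) ∂μH[4]) < 2) → ∀ ε : ℝ, 0 < ε → ∃ t : ℝ, T ≤ t ∧ μH[4] (Set.range (F t)) ≤ ENNReal.ofReal (1 + ε) * μH[4] (Metric.sphere (0 : EuclideanSpace ℝ (Fin 5)) 1)) := by
  intro M _ _ _ _ _ _ _ F ν T hU hemb hN himm hun hνN hνs hvel hsep hent
  exact h M F ν T ⟨hU, hemb, hN, himm, hun, hνN, hνs, hvel⟩ hsep hent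

/-- **Conversely, the item as typed implies the folded `stub_areaToFloor` shape** (destructure `IsCylinderMCF`;
`SeparatesEnds` and `cylEntropy` unfold by `rfl`), so the two are equivalent and a proof of the item discharges the
registered stub of line `killing-flux` verbatim. [folklore] -/
theorem stubShape_of_immortalAreaToFloor
    (h : haveI : (Literature.Geometry.Riemannian.euclideanMetric (EuclideanSpace ℝ (Fin 6))).HasLeviCivita := Literature.Geometry.Riemannian.instHasLeviCivitaEuclideanMetric; ∀ (M : Type) [TopologicalSpace M] [T2Space M] [SecondCountableTopology M] [ChartedSpace (EuclideanSpace ℝ (Fin 4)) M] [IsManifold (𝓡 4) ∞ M] [CompactSpace M] [ConnectedSpace M] (F : ℝ → M → EuclideanSpace ℝ (Fin 6)) (ν : ℝ → M → EuclideanSpace ℝ (Fin 6)) (T : ℝ), (∃ U : Set ℝ, IsOpen U ∧ Set.Ici T ⊆ U ∧ ContMDiffOn (𝓘(ℝ, ℝ).prod (𝓡 4)) (𝓡 6) ∞ (fun q : ℝ × M => F q.1 q.2) (U ×ˢ Set.univ)) → (∀ t, T ≤ t → Manifold.IsSmoothEmbedding (𝓡 4) (𝓡 6) ∞ (F t)) →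 (∀ t, T ≤ t → ∀ x, ∑ i : Fin 5, F t x (Fin.castSucc i) ^ 2 = 1) → ∀ himm : (∀ t, T ≤ t → (Literature.Geometry.Riemannian.euclideanMetric (EuclideanSpace ℝ (Fin 6))).IsSpacelikeImmersion (𝓡 4) (F t)), (∀ t, T ≤ t → (Literature.Geometry.Riemannian.euclideanMetric (EuclideanSpace ℝ (Fin 6))).IsUnitNormal (𝓡 4) (F t) (ν t) 1) → (∀ t, T ≤ t → ∀ x, ∑ i : Fin 5, ν t x (Fin.castSucc i) * F t x (Fin.castSucc i) = 0) → (∀ t, T ≤ t → ContMDiff (𝓡 4) (𝓡 6) ∞ (ν t)) → (∀ t (ht : T ≤ t) (x : M), mfderiv 𝓘(ℝ, ℝ) (𝓡 6) (fun s => F s x) t (1 : ℝ) = -((Literature.Geometry.Riemannian.euclideanMetric (EuclideanSpace ℝ (Fin 6))).meanCurvature (F t) Literature.Geometry.Lorentzian.PseudoRiemannianMetric.contMDiff_pullbackBilin_holds (himm t ht) (ν t) x) • ν t x) → (∀ t, T ≤ t → (∃ R : ℝ, ∀ a b : EuclideanSpace ℝ (Fin 6), ∑ i : Fin 5, a (Fin.castSucc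 i) ^ 2 = 1 → ∑ i : Fin 5, b (Fin.castSucc i) ^ 2 = 1 → a 5 ≤ -R → R ≤ b 5 → ¬ JoinedIn ({z : EuclideanSpace ℝ (Fin 6) | ∑ i : Fin 5, z (Fin.castSucc i) ^ 2 = 1} \ Set.range (F t)) a b)) → (∀ t, T ≤ t → (⨆ (p : EuclideanSpace ℝ (Fin 6)) (_ : ∑ i : Fin 5, p (Fin.castSucc i) ^ 2 = 1) (τ : ℝ) (_ : 0 < τ), (μH[4] (Metric.sphere (0 : EuclideanSpace ℝ (Fin 5)) 1))⁻¹ * ∫⁻ z in Set.range (F t), ENNReal.ofReal ((∑' k : ℕ, Real.exp (-((k : ℝ) * ((k : ℝ) + 3)) * τ) * ((2 * (k : ℝ) + 3) / 3) * ∑ l ∈ Finset.range (k / 2 + 1), (-1 : ℝ) ^ l * (∏ j ∈ Finset.range (k - l), ((3 : ℝ) / 2 + (j : ℝ))) / (((l.factorial : ℕ) : ℝ) * (((k - 2 * l).factorial : ℕ) : ℝ)) * (2 * ∑ i : Fin 5, z (Fin.castSucc i) * p (Fin.castSucc i)) ^ (k - 2 * l)) * Real.exp (-((z 5 - p 5)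 ^ 2) / (4 * τ))) ∂μH[4]) < 2) → ∀ ε : ℝ, 0 < ε → ∃ t : ℝ, T ≤ t ∧ μH[4] (Set.range (F t)) ≤ ENNReal.ofReal (1 + ε) * μH[4] (Metric.sphere (0 : EuclideanSpace ℝ (Fin 5)) 1)) :
    ∀ (M : Type) [TopologicalSpace M] [T2Space M] [SecondCountableTopology M]
      [ChartedSpace (EuclideanSpace ℝ (Fin 4)) M] [IsManifold (𝓡 4) ∞ M] [CompactSpace M]
      [ConnectedSpace M]
      (F : ℝ → M → EuclideanSpace ℝ (Fin 6)) (ν : ℝ → M → EuclideanSpace ℝ (Fin 6)) (T : ℝ),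
      IsCylinderMCF M F ν T →
      (∀ t, T ≤ t → SeparatesEnds (Set.range (F t))) →
      (∀ t, T ≤ t → cylEntropy (Set.range (F t)) < 2) →
      ∀ ε : ℝ, 0 < ε → ∃ t : ℝ, T ≤ t ∧
        μH[4] (Set.range (F t)) ≤
          ENNReal.ofReal (1 + ε) * μH[4] (Metric.sphere (0 : EuclideanSpace ℝ (Fin 5)) 1) := by
  intro M _ _ _ _ _ _ _ F ν T hF hsep hent
  exact h M F ν T hF.contMDiffOn hF.isSmoothEmbedding hF.mem_cyl hF.isSpacelikeImmersion hF.isUnitNormal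
    hF.normal_tangent hF.contMDiff_normal hF.velocity_eq hsep hent

/-- **The crux `AreaQuantization` (stmt-SmoothPoincare4-17175) implies the item `ImmortalAreaToFloor`
(stmt-SmoothPoincare4-17197).**  Pure logic over the landed dissipation budget `stub_dissipationBudget` and the landed
glue `helper_areaToFloorOfQuantization` (areas antitone, `≥ vol S⁴` by the area floor, `< 2 vol S⁴` by `λ_cyl < 2`;
the budget yields good times `r_n → ∞` with `∫ H² → 0`; quantization gives `A_∞ = m · vol`, and `vol ≤ A_∞ < 2 vol`
forces `m = 1`).  The route decl `AreaQuantization` is the quantization hypothesis of that helper with `SeparatesEnds`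
unfolded (`rfl`). [folklore] -/
theorem immortalAreaToFloor_of_areaQuantization
    (hQ : Summit.SmoothPoincare4.SmoothPoincare4.Theses.CylinderEntropy.AreaQuantization) :
    (haveI : (Literature.Geometry.Riemannian.euclideanMetric (EuclideanSpace ℝ (Fin 6))).HasLeviCivita := Literature.Geometry.Riemannian.instHasLeviCivitaEuclideanMetric; ∀ (M : Type) [TopologicalSpace M] [T2Space M] [SecondCountableTopology M] [ChartedSpace (EuclideanSpace ℝ (Fin 4)) M] [IsManifold (𝓡 4) ∞ M] [CompactSpace M] [ConnectedSpace M] (F : ℝ → M → EuclideanSpace ℝ (Fin 6)) (ν : ℝ → M → EuclideanSpace ℝ (Fin 6)) (T : ℝ), (∃ U : Set ℝ, IsOpen U ∧ Set.Ici T ⊆ U ∧ ContMDiffOn (𝓘(ℝ, ℝ).prod (𝓡 4)) (𝓡 6) ∞ (fun q : ℝ × M => F q.1 q.2) (U ×ˢ Set.univ)) → (∀ t, T ≤ t → Manifold.IsSmoothEmbedding (𝓡 4) (𝓡 6) ∞ (F t)) → (∀ t, T ≤ t → ∀ x, ∑ i : Fin 5, F t x (Fin.castSucc i) ^ 2 =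 1) → ∀ himm : (∀ t, T ≤ t → (Literature.Geometry.Riemannian.euclideanMetric (EuclideanSpace ℝ (Fin 6))).IsSpacelikeImmersion (𝓡 4) (F t)), (∀ t, T ≤ t → (Literature.Geometry.Riemannian.euclideanMetric (EuclideanSpace ℝ (Fin 6))).IsUnitNormal (𝓡 4) (F t) (ν t) 1) → (∀ t, T ≤ t → ∀ x, ∑ i : Fin 5, ν t x (Fin.castSucc i) * F t x (Fin.castSucc i) = 0) → (∀ t, T ≤ t → ContMDiff (𝓡 4) (𝓡 6) ∞ (ν t)) → (∀ t (ht : T ≤ t) (x : M), mfderiv 𝓘(ℝ, ℝ) (𝓡 6) (fun s => F s x) t (1 : ℝ) = -((Literature.Geometry.Riemannian.euclideanMetric (EuclideanSpace ℝ (Fin 6))).meanCurvature (F t) Literature.Geometry.Lorentzian.PseudoRiemannianMetric.contMDiff_pullbackBilin_holds (himm t ht) (ν t) x) • ν t x) → (∀ t, T ≤ t → (∃ R : ℝ, ∀ a b : EuclideanSpace ℝ (Fin 6), ∑ i : Fin 5, a (Fin.castSucc i) ^ 2 = 1 → ∑ i : Fin 5, b (Fin.castSucc i) ^ 2 = 1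 → a 5 ≤ -R → R ≤ b 5 → ¬ JoinedIn ({z : EuclideanSpace ℝ (Fin 6) | ∑ i : Fin 5, z (Fin.castSucc i) ^ 2 = 1} \ Set.range (F t)) a b)) → (∀ t, T ≤ t → (⨆ (p : EuclideanSpace ℝ (Fin 6)) (_ : ∑ i : Fin 5, p (Fin.castSucc i) ^ 2 = 1) (τ : ℝ) (_ : 0 < τ), (μH[4] (Metric.sphere (0 : EuclideanSpace ℝ (Fin 5)) 1))⁻¹ * ∫⁻ z in Set.range (F t), ENNReal.ofReal ((∑' k : ℕ, Real.exp (-((k : ℝ) * ((k : ℝ) + 3)) * τ) * ((2 * (k : ℝ) + 3) / 3) * ∑ l ∈ Finset.range (k / 2 + 1), (-1 : ℝ) ^ l * (∏ j ∈ Finset.range (k - l), ((3 : ℝ) / 2 + (j : ℝ))) / (((l.factorial : ℕ) : ℝ) * (((k - 2 * l).factorial : ℕ) : ℝ)) * (2 * ∑ i : Fin 5, z (Fin.castSucc i) * p (Fin.castSucc i)) ^ (k - 2 * l)) * Real.exp (-((z 5 - p 5) ^ 2) / (4 * τ))) ∂μH[4]) < 2) → ∀ ε : ℝ, 0 < ε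 → ∃ t : ℝ, T ≤ t ∧ μH[4] (Set.range (F t)) ≤ ENNReal.ofReal (1 + ε) * μH[4] (Metric.sphere (0 : EuclideanSpace ℝ (Fin 5)) 1)) :=
  immortalAreaToFloor_of_stubShape
    (helper_areaToFloorOfQuantization stub_dissipationBudget
      (fun M _ _ _ _ _ _ _ _ _ ι ν hemb hN hsep himm hun hνN hνs B hB hH A hA hArea =>
        hQ M ι ν hemb hN hsep himm hun hνN hνs B hB hH A hA hArea))

/-- **Allard's integrality of limits implies the item `ImmortalAreaToFloor` (stmt-SmoothPoincare4-17197).**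
CONDITIONAL on the named fact `Allard1972_integralDensityOfLimits_cylinderCrossSections` (Allard 1972, Thm. 6.4 with
§3.5, rendered without varifolds; statement only): the landed `helper_areaQuantizationOfAllard` turns it into area
quantization, and `immortalAreaToFloor_of_stubShape ∘ helper_areaToFloorOfQuantization stub_dissipationBudget` does the
rest. [cite: Allard1972, Thm. 6.4 and 3.5] -/
theorem immortalAreaToFloor_of_allard
    (hA : Literature.Geometry.GeometricMeasureTheory.Allard1972_integralDensityOfLimits_cylinderCrossSections) :
    (haveI : (Literature.Geometry.Riemannian.euclideanMetric (EuclideanSpace ℝ (Fin 6))).HasLeviCivita := Literature.Geometry.Riemannian.instHasLeviCivitaEuclideanMetric; ∀ (M : Type) [TopologicalSpace M] [T2Space M] [SecondCountableTopology M] [ChartedSpace (EuclideanSpace ℝ (Fin 4)) M] [IsManifold (𝓡 4) ∞ M] [CompactSpace M] [ConnectedSpace M] (F : ℝ → M → EuclideanSpace ℝ (Fin 6)) (ν : ℝ → M → EuclideanSpace ℝ (Fin 6)) (T : ℝ), (∃ U : Set ℝ, IsOpen U ∧ Set.Ici T ⊆ U ∧ ContMDiffOn (𝓘(ℝ, ℝ).prod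 (𝓡 4)) (𝓡 6) ∞ (fun q : ℝ × M => F q.1 q.2) (U ×ˢ Set.univ)) → (∀ t, T ≤ t → Manifold.IsSmoothEmbedding (𝓡 4) (𝓡 6) ∞ (F t)) → (∀ t, T ≤ t → ∀ x, ∑ i : Fin 5, F t x (Fin.castSucc i) ^ 2 = 1) → ∀ himm : (∀ t, T ≤ t → (Literature.Geometry.Riemannian.euclideanMetric (EuclideanSpace ℝ (Fin 6))).IsSpacelikeImmersion (𝓡 4) (F t)), (∀ t, T ≤ t → (Literature.Geometry.Riemannian.euclideanMetric (EuclideanSpace ℝ (Fin 6))).IsUnitNormal (𝓡 4) (F t) (ν t) 1) → (∀ t, T ≤ t → ∀ x, ∑ i : Fin 5, ν t x (Fin.castSucc i) * F t x (Fin.castSucc i) = 0) → (∀ t, T ≤ t → ContMDiff (𝓡 4) (𝓡 6) ∞ (ν t)) → (∀ t (ht : T ≤ t) (x : M), mfderiv 𝓘(ℝ, ℝ) (𝓡 6) (fun s => F s x) t (1 : ℝ) = -((Literature.Geometry.Riemannian.euclideanMetric (EuclideanSpace ℝ (Fin 6))).meanCurvature (F t) Literature.Geometry.Lorentzian.PseudoRiemannianMetric.contMDiff_pullbackBilin_holds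 (himm t ht) (ν t) x) • ν t x) → (∀ t, T ≤ t → (∃ R : ℝ, ∀ a b : EuclideanSpace ℝ (Fin 6), ∑ i : Fin 5, a (Fin.castSucc i) ^ 2 = 1 → ∑ i : Fin 5, b (Fin.castSucc i) ^ 2 = 1 → a 5 ≤ -R → R ≤ b 5 → ¬ JoinedIn ({z : EuclideanSpace ℝ (Fin 6) | ∑ i : Fin 5, z (Fin.castSucc i) ^ 2 = 1} \ Set.range (F t)) a b)) → (∀ t, T ≤ t → (⨆ (p : EuclideanSpace ℝ (Fin 6)) (_ : ∑ i : Fin 5, p (Fin.castSucc i) ^ 2 = 1) (τ : ℝ) (_ : 0 < τ), (μH[4] (Metric.sphere (0 : EuclideanSpace ℝ (Fin 5)) 1))⁻¹ * ∫⁻ z in Set.range (F t), ENNReal.ofReal ((∑' k : ℕ, Real.exp (-((k : ℝ) * ((k : ℝ) + 3)) * τ) * ((2 * (k : ℝ) + 3) / 3) * ∑ l ∈ Finset.range (k / 2 + 1), (-1 : ℝ) ^ l * (∏ j ∈ Finset.range (k - l), ((3 : ℝ) / 2 + (j : ℝ))) / (((l.factorial : ℕ) : ℝ) * (((k - 2 *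 l).factorial : ℕ) : ℝ)) * (2 * ∑ i : Fin 5, z (Fin.castSucc i) * p (Fin.castSucc i)) ^ (k - 2 * l)) * Real.exp (-((z 5 - p 5) ^ 2) / (4 * τ))) ∂μH[4]) < 2) → ∀ ε : ℝ, 0 < ε → ∃ t : ℝ, T ≤ t ∧ μH[4] (Set.range (F t)) ≤ ENNReal.ofReal (1 + ε) * μH[4] (Metric.sphere (0 : EuclideanSpace ℝ (Fin 5)) 1)) :=
  immortalAreaToFloor_of_stubShape
    (helper_areaToFloorOfQuantization stub_dissipationBudget (helper_areaQuantizationOfAllard hA))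

end Summit.SmoothPoincare4.SmoothPoincare4.Theorems

end
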